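import Summits.QuantumFields.YangMills.Theorems.HypercubicLimit.Negative.NonabelianLoadBearing
import Summits.QuantumFields.YangMills.Theorems.MirrorModularBoostsHypercubicLimitPlaneLimitsDefs
import Summits.QuantumFields.YangMills.Theorems.MirrorModularBoostsHypercubicLimitClosureHalvesDefs
import Summits.QuantumFields.YangMills.Theorems.PencilRigidityDiagonalMirrorRPRStubRpClosureDefs
import Summits.QuantumFields.YangMills.Theorems.PencilRigidityCurvatureChannel

/-!
# Negative knowledge on D1 `stub_diagRPOfPlaneLimits` of crux `WeakCouplingHypercubicLimitRP` (stmt-QuantumFields-27398), I: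
# `T`-independence and the load-bearing hypothesis

D1 (registered skeleton `Cruxes/WeakCouplingHypercubicLimitRP/Lines/Sketch.lean`, l.1618): for every compact gauge group `G`,
`LatticeRep r`, scheme `sch`, subsequence `φ` and plane-limit family `T`,
`HasWeakCouplingLimit → PolyVolume → PolyRenorm → UniformFunctionalBoundPlanes → (∃ Δ C, 0 < Δ ∧ RPSpectral r sch Δ C) →
PlaneLimits r sch φ T → DiagonalFrameRP (planeSum T)`.

Landed here (standing disprover `cdisprove-27398-1`; work file `Cruxes/WeakCouplingHypercubicLimitRP/Disproof.lean`):
* §A `diagonalFrameRP_planeSum_iff_of_planeLimits` — D1's conclusion does not depend on the choice of `T` among plane limits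
  (the E2 form in a diagonal frame reads `planeSum T` only on off-diagonal tensors, pinned by `PlaneLimits.1`): the values of
  `T` off `⁰𝒮`, unconstrained by `PlaneLimits`, cannot refute D1.
* §B LOAD-BEARING: `exists_counterexample_without_degreeThreeConvergence` — given ANY tempered family `Φ` that is the vacuum
  family off degree `3` and fails diagonal-frame RP (the landed phantom family of `DiagonalMirrorRPR/Negative` is one), the
  trivial gauge group with the weakly silenced scheme satisfies EVERY hypothesis of D1 except the degree-3 instance of
  `PlaneLimits.1`, with `¬ DiagonalFrameRP (planeSum T)`: any proof of D1 must use convergence on `⁰𝒮` in degree 3, and none of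
  `HasWeakCouplingLimit / PolyVolume / PolyRenorm / UFB / RPSpectral / StrictMono φ` constrains the limit family by itself.
Companion file II (`DiagRPOfPlaneLimitsJunkGroup`): D1 HOLDS for every one-element gauge group.
HONEST REGISTER: bookkeeping for the line; nothing here bears on the mass gap.
-/

noncomputable section

open scoped SchwartzMap ComplexConjugate InnerProductSpace
open MeasureTheory Filter Topology Complex
open Literature.MathematicalPhysics.AQFT Literature.MathematicalPhysics.QuantumLattice
open Literature.MathematicalPhysics.QuantumFieldTheory
open Literature.Probability.LatticeModels (box Site mem_box)
open Summit.QuantumFields.YangMills.Cruxes.HypercubicLimit.CouplingResponse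
open Summit.QuantumFields.YangMills.Cruxes.DiagonalMirrorRPR.ParityBridgeColdTraces (DiagonalFrameRP)
open Summit.QuantumFields.YangMills.Theorems.OSLegsFromFemtoAndGap (latticeDistStr torusMomentStr
  latticeDistStr_apply)
open Summit.QuantumFields.YangMills.Theorems.HypercubicLimit.Negative (punitRep)
open Summit.QuantumFields.YangMills.Theorems.CurvatureChannel (isOffDiagonal_linActMulti_of_isAppendTensorOf)

namespace Summit.QuantumFields.YangMills.Theorems.WeakCouplingHypercubicLimitRP.Negative.DiagRPOfPlaneLimits

/-! ## §A Junk audit: D1's truth value does not depend on `T` (only on `(G, r, sch, φ)`) -/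

section TIndependence

variable {G : Type} [Group G] [TopologicalSpace G] [IsTopologicalGroup G] [CompactSpace G]
  [MeasurableSpace G] [BorelSpace G]

/-- Two `PlaneLimits` packages of the same `(r, sch, φ)` have the same summed family on `⁰𝒮`. [folklore] -/
theorem planeSum_eq_of_planeLimits {r : LatticeRep G} {sch : SpeciesScheme (YMSpecies G)} {φ : ℕ → ℕ}
    {T T' : (n : ℕ) → (Fin n → Plane) → (𝓢((Fin n → EuclideanSpace ℝ (Fin 4)), ℂ) →L[ℂ] ℂ)}
    (hT : PlaneLimits r sch φ T) (hT' : PlaneLimits r sch φ T') {n : ℕ}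
    {F : 𝓢((Fin n → EuclideanSpace ℝ (Fin 4)), ℂ)} (hF : IsOffDiagonal F) :
    planeSum T n F = planeSum T' n F :=
  tendsto_nhds_unique (hT.tendsto_planeSum F hF) (hT'.tendsto_planeSum F hF)

omit [Group G] [TopologicalSpace G] [IsTopologicalGroup G] [CompactSpace G] [MeasurableSpace G]
  [BorelSpace G] in
/-- `DiagonalFrameRP` only reads a family on `⁰𝒮`: the E2 witnesses `θFᵢ* ⊗ Fⱼ` are off-diagonal and every pull-back
`linActMulti R` preserves `⁰𝒮` (`CurvatureChannel.isOffDiagonal_linActMulti_of_isAppendTensorOf`). [folklore] -/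
theorem diagonalFrameRP_congr_offDiagonal {S S' : SchwingerFamily (EuclideanSpace ℝ (Fin 4))}
    (h : ∀ (n : ℕ) (F : 𝓢((Fin n → EuclideanSpace ℝ (Fin 4)), ℂ)), IsOffDiagonal F → S n F = S' n F)
    (hS : DiagonalFrameRP S) : DiagonalFrameRP S' := by
  intro R a b ha hb hR N deg lab F hF H hH
  have hz := hS R a b ha hb hR N deg lab F hF H hH
  have hterm : ∀ i j,
      (SchwingerFamily.toLabelled (fun n => (S' n).comp (linActMulti R))) (deg i + deg j)
          (Fin.append (lab i ∘ Fin.rev) (lab j)) (H i j) =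
        (SchwingerFamily.toLabelled (fun n => (S n).comp (linActMulti R))) (deg i + deg j)
          (Fin.append (lab i ∘ Fin.rev) (lab j)) (H i j) := by
    intro i j
    rw [SchwingerFamily.toLabelled_apply, SchwingerFamily.toLabelled_apply, ContinuousLinearMap.comp_apply,
      ContinuousLinearMap.comp_apply]
    exact (h _ _ (isOffDiagonal_linActMulti_of_isAppendTensorOf R (hF i) (hF j) (hH i j))).symm
  simp only [hterm]
  exact hz

/-- **T-independence of D1.** For fixed `(r, sch, φ)` the conclusion `DiagonalFrameRP (planeSum T)` has the same truth
value for every `T` with `PlaneLimits r sch φ T`: no junk-`T` refutation of D1 exists (values of `T` off `⁰𝒮`, which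
`PlaneLimits` leaves free, are never read by E2 in a diagonal frame). [folklore] -/
theorem diagonalFrameRP_planeSum_iff_of_planeLimits {r : LatticeRep G} {sch : SpeciesScheme (YMSpecies G)}
    {φ : ℕ → ℕ} {T T' : (n : ℕ) → (Fin n → Plane) → (𝓢((Fin n → EuclideanSpace ℝ (Fin 4)), ℂ) →L[ℂ] ℂ)}
    (hT : PlaneLimits r sch φ T) (hT' : PlaneLimits r sch φ T') :
    DiagonalFrameRP (planeSum T) ↔ DiagonalFrameRP (planeSum T') :=
  ⟨diagonalFrameRP_congr_offDiagonal fun _ _ hF => planeSum_eq_of_planeLimits hT hT' hF,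
    diagonalFrameRP_congr_offDiagonal fun _ _ hF => planeSum_eq_of_planeLimits hT' hT hF⟩

end TIndependence

/-! ## §B Load-bearing analysis: the convergence clause `PlaneLimits.1` IN DEGREE 3 is load-bearing -/

section LoadBearing

variable {G : Type} [Group G] [TopologicalSpace G] [IsTopologicalGroup G] [CompactSpace G]
  [MeasurableSpace G] [BorelSpace G]

/-- In arity `0` every plane-string distribution is evaluation (the weight is `∫ 1 dμ = 1` and `(box L)⁰` is a point),
for EVERY gauge group and scheme. [folklore] -/
theorem planeDist_arity_zero (r : LatticeRep G) (sch : SpeciesScheme (YMSpecies G)) (k : ℕ) (q : Fin 0 → Plane)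
    (F : 𝓢((Fin 0 → EuclideanSpace ℝ (Fin 4)), ℂ)) : planeDist r sch k 0 q F = F 0 := by
  haveI := isProbabilityMeasure_wilsonMeasure (d := 4) (L := 2 * sch.L k + 1) r.ρ r.continuous (sch.β k)
  have hW : ∀ x : Fin 0 → Site 4, torusMomentStr r.ρ (sch.β k) (sch.L k) (fun i => (planeSpecies r (q i)).F)
      (fun _ => sch.m r.curvature k / 6) x = 1 := fun x => by
    unfold torusMomentStr
    simp only [Finset.univ_eq_empty, Finset.prod_empty, integral_const, smul_eq_mul, probReal_univ, one_mul]
  simp only [planeDist, latticeDistStr_apply, pow_zero, Complex.ofReal_one, one_smul, Fintype.piFinset_of_isEmpty,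
    Finset.univ_unique, Finset.sum_singleton, hW, one_mul]
  exact congrArg F (Subsingleton.elim _ _)

/-- With the curvature renormalisation silenced (`c_k = 0`) every plane-string distribution of positive arity vanishes. [folklore] -/
theorem planeDist_succ_eq_zero_of_c_eq_zero (r : LatticeRep G) (sch : SpeciesScheme (YMSpecies G)) {k : ℕ}
    (hc : sch.c r.curvature k = 0) (n : ℕ) (q : Fin (n + 1) → Plane)
    (F : 𝓢((Fin (n + 1) → EuclideanSpace ℝ (Fin 4)), ℂ)) : planeDist r sch k (n + 1) q F = 0 := by
  simp only [planeDist, _root_.smul_apply, smul_eq_mul, hc, zero_mul, zero_pow (Nat.succ_ne_zero n),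
    Complex.ofReal_zero]

/-- The **weakly silenced scheme**: the zero scheme (`a_k = 1/(k+1)`, `L_k = (k+1)²`, `c = m = 0`) with `β_k = k → ∞`. [folklore] -/
def weakScheme (ι : Type) : SpeciesScheme ι :=
  { SpeciesScheme.zero ι with β := fun k => (k : ℝ) }

omit [Group G] [TopologicalSpace G] [IsTopologicalGroup G] [CompactSpace G] [MeasurableSpace G] [BorelSpace G] in
/-- `β_k = k → ∞`. [folklore] -/
theorem hasWeakCouplingLimit_weakScheme (ι : Type) : (weakScheme ι).HasWeakCouplingLimit :=
  tendsto_natCast_atTop_atTop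

omit [Group G] [TopologicalSpace G] [IsTopologicalGroup G] [CompactSpace G] [MeasurableSpace G] [BorelSpace G] in
/-- `a_k⁻¹ = k + 1 = a_k L_k`: `PolyVolume` with `N = 1`. [folklore] -/
theorem polyVolume_weakScheme (ι : Type) : PolyVolume (weakScheme ι) := by
  refine ⟨1, le_rfl, Filter.Eventually.of_forall fun k => ?_⟩
  show (((k : ℝ) + 1)⁻¹)⁻¹ ≤ (((k : ℝ) + 1)⁻¹ * (((k + 1) ^ 2 : ℕ) : ℝ)) ^ 1
  rw [inv_inv, pow_one]
  push_cast
  have hk : (0 : ℝ) < (k : ℝ) + 1 := by positivity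
  rw [sq, ← mul_assoc, inv_mul_cancel₀ hk.ne', one_mul]

/-- `c = 0`: `PolyRenorm` with `Q = 0`. [folklore] -/
theorem polyRenorm_weakScheme (r : LatticeRep G) : PolyRenorm r (weakScheme (YMSpecies G)) :=
  ⟨0, fun k => by simp [weakScheme, SpeciesScheme.zero]⟩

/-- UFB for the weakly silenced scheme (every `G`): arity `0` is evaluation, positive arities vanish. [folklore] -/
theorem uniformFunctionalBoundPlanes_weakScheme (r : LatticeRep G) :
    UniformFunctionalBoundPlanes r (weakScheme (YMSpecies G)) := by
  refine ⟨0, 1, 0, fun n q F _ k => ?_⟩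
  rw [Real.rpow_zero, mul_one, one_mul, Nat.mul_zero]
  cases n with
  | zero =>
    rw [planeDist_arity_zero]
    exact norm_le_schwartzNorm 0 F 0
  | succ n =>
    rw [planeDist_succ_eq_zero_of_c_eq_zero r _ (by rfl) n q F, norm_zero]
    exact schwartzNorm_nonneg _ _

/-- For the trivial gauge group every configuration functional is constant, so `RPSpectral` holds at every rate with
thermal constant `0` (both sides of the clustering inequality vanish). [folklore] -/
theorem rpSpectral_of_subsingleton [Subsingleton G] (r : LatticeRep G) (sch : SpeciesScheme (YMSpecies G)) (Δ : ℝ) :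
    RPSpectral r sch Δ 0 := by
  refine Filter.Eventually.of_forall fun k S T n _ _ Y B _ _ _ => ?_
  haveI := isProbabilityMeasure_wilsonMeasure (d := 4) (L := 2 * S + 1) r.ρ r.continuous (sch.β k)
  obtain ⟨y, rfl⟩ : ∃ y : ℝ, Y = fun _ => y :=
    ⟨Y (fun _ => 1), funext fun V => congrArg Y (Subsingleton.elim _ _)⟩
  simp only [integral_const, smul_eq_mul, probReal_univ, one_mul]
  have h0 : y * y - y ^ 2 = 0 := by ring
  rw [h0, abs_zero, mul_zero, zero_mul, zero_mul, add_zero]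

/-- A reference plane (the `01`-plane). [folklore] -/
def plane₀ : Plane := ⟨((0 : Fin 4), (1 : Fin 4)), by decide⟩

variable (Φ : (n : ℕ) → (𝓢((Fin n → EuclideanSpace ℝ (Fin 4)), ℂ) →L[ℂ] ℂ))

/-- The **phantom plane family** of `Φ`: `Φ` placed on the constant `01`-string, zero on every other string, so that
`planeSum (phantomT Φ) = Φ`. [folklore] -/
def phantomT : (n : ℕ) → (Fin n → Plane) → (𝓢((Fin n → EuclideanSpace ℝ (Fin 4)), ℂ) →L[ℂ] ℂ) :=
  fun n q => if q = fun _ => plane₀ then Φ n else 0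

omit [Group G] [TopologicalSpace G] [IsTopologicalGroup G] [CompactSpace G] [MeasurableSpace G] [BorelSpace G] in
/-- `planeSum (phantomT Φ) = Φ`. [folklore] -/
theorem planeSum_phantomT : planeSum (phantomT Φ) = Φ := by
  funext n
  simp [planeSum, phantomT, Finset.sum_ite_eq']

omit [Group G] [TopologicalSpace G] [IsTopologicalGroup G] [CompactSpace G] [MeasurableSpace G] [BorelSpace G] in
/-- The phantom plane family inherits the growth clause `PlaneLimits.2` (with `β = 0`). [folklore] -/
theorem phantomT_bound {s : ℕ} {α : ℝ} (hα : 0 ≤ α)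
    (h : ∀ (n : ℕ) (F : 𝓢((Fin n → EuclideanSpace ℝ (Fin 4)), ℂ)), ‖Φ n F‖ ≤ α * schwartzNorm (n * s) F) :
    ∃ (s : ℕ) (α β : ℝ), ∀ (n : ℕ) (q : Fin n → Plane) (F : 𝓢((Fin n → EuclideanSpace ℝ (Fin 4)), ℂ)),
      ‖phantomT Φ n q F‖ ≤ α * (n.factorial : ℝ) ^ β * schwartzNorm (n * s) F := by
  refine ⟨s, α, 0, fun n q F => ?_⟩
  rw [Real.rpow_zero, mul_one]
  unfold phantomT
  split_ifs
  · exact h n F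
  · rw [_root_.zero_apply, norm_zero]
    exact mul_nonneg hα (schwartzNorm_nonneg _ _)

omit Φ in
/-- Over the weakly silenced scheme of the trivial gauge group, a family that is the vacuum family in degree `n`
(`n = 0`: evaluation; `n ≥ 1`: zero) IS the plane limit in degree `n`, along every `φ`. [folklore] -/
theorem tendsto_planeDist_phantomT [MeasurableSpace PUnit] [BorelSpace PUnit]
    {Φ : (n : ℕ) → (𝓢((Fin n → EuclideanSpace ℝ (Fin 4)), ℂ) →L[ℂ] ℂ)}
    (h0 : ∀ F : 𝓢((Fin 0 → EuclideanSpace ℝ (Fin 4)), ℂ), Φ 0 F = F 0) (hvac : ∀ n : ℕ, n ≠ 0 → n ≠ 3 → Φ n = 0)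
    {φ : ℕ → ℕ} {n : ℕ} (hn : n ≠ 3) (q : Fin n → Plane) (F : 𝓢((Fin n → EuclideanSpace ℝ (Fin 4)), ℂ)) :
    Tendsto (fun k => planeDist punitRep (weakScheme (YMSpecies PUnit)) (φ k) n q F) atTop (𝓝 (phantomT Φ n q F)) := by
  cases n with
  | zero =>
    have hq : q = fun _ => plane₀ := Subsingleton.elim _ _
    have hT : phantomT Φ 0 q F = F 0 := by rw [phantomT, if_pos hq, h0]
    simp only [planeDist_arity_zero, hT]
    exact tendsto_const_nhds
  | succ n =>
    have hT : phantomT Φ (n + 1) q F = 0 := by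
      unfold phantomT
      split_ifs
      · rw [hvac (n + 1) (Nat.succ_ne_zero n) hn, _root_.zero_apply]
      · rfl
    simp only [planeDist_succ_eq_zero_of_c_eq_zero punitRep (weakScheme (YMSpecies PUnit)) rfl, hT]
    exact tendsto_const_nhds

/-- **LOAD-BEARING: any proof of D1 must use the convergence clause `PlaneLimits.1` in degree 3.**
Given any tempered family `Φ` on `ℝ⁴` that is the vacuum family off degree `3` (`Φ₀ F = F 0`, `Φₙ = 0` for `n ∉ {0,3}`),
obeys one uniform Schwartz bound, and FAILS diagonal-frame reflection positivity — the landed phantom family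
`DiagonalMirrorRPR.Negative.Phantom.phantomFamily` is one (`exists_diagonalFrame_not_isReflectionPositive_phantomFamily`,
`phantomFamily_apply`, `phantom_of_ne_three`, `vacuumFamily_apply`) — the trivial gauge group `PUnit` with `punitRep`, the
weakly silenced scheme `weakScheme` and the phantom plane family `phantomT Φ` satisfy, along EVERY `φ`, all hypotheses of D1
(`HasWeakCouplingLimit`, `PolyVolume`, `PolyRenorm`, `UniformFunctionalBoundPlanes`, `RPSpectral` with `Δ = 1`, the growth
clause `PlaneLimits.2`, and `PlaneLimits.1` in every degree `n ≠ 3`) while the conclusion `DiagonalFrameRP (planeSum T)` FAILS.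
[folklore] -/
theorem exists_counterexample_without_degreeThreeConvergence [MeasurableSpace PUnit] [BorelSpace PUnit]
    (Φ : (n : ℕ) → (𝓢((Fin n → EuclideanSpace ℝ (Fin 4)), ℂ) →L[ℂ] ℂ))
    (h0 : ∀ F : 𝓢((Fin 0 → EuclideanSpace ℝ (Fin 4)), ℂ), Φ 0 F = F 0) (hvac : ∀ n : ℕ, n ≠ 0 → n ≠ 3 → Φ n = 0)
    {s : ℕ} {α : ℝ} (hα : 0 ≤ α)
    (hbd : ∀ (n : ℕ) (F : 𝓢((Fin n → EuclideanSpace ℝ (Fin 4)), ℂ)), ‖Φ n F‖ ≤ α * schwartzNorm (n * s) F)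
    (hnot : ¬ DiagonalFrameRP Φ) (φ : ℕ → ℕ) :
    (weakScheme (YMSpecies PUnit)).HasWeakCouplingLimit ∧ PolyVolume (weakScheme (YMSpecies PUnit)) ∧
      PolyRenorm punitRep (weakScheme (YMSpecies PUnit)) ∧
      UniformFunctionalBoundPlanes punitRep (weakScheme (YMSpecies PUnit)) ∧
      (∃ Δ C : ℝ, 0 < Δ ∧ RPSpectral punitRep (weakScheme (YMSpecies PUnit)) Δ C) ∧
      (∀ (n : ℕ) (q : Fin n → Plane) (F : 𝓢((Fin n → EuclideanSpace ℝ (Fin 4)), ℂ)), n ≠ 3 → IsOffDiagonal F →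
        Tendsto (fun k => planeDist punitRep (weakScheme (YMSpecies PUnit)) (φ k) n q F) atTop
          (𝓝 (phantomT Φ n q F))) ∧
      (∃ (s : ℕ) (α β : ℝ), ∀ (n : ℕ) (q : Fin n → Plane) (F : 𝓢((Fin n → EuclideanSpace ℝ (Fin 4)), ℂ)),
        ‖phantomT Φ n q F‖ ≤ α * (n.factorial : ℝ) ^ β * schwartzNorm (n * s) F) ∧
      ¬ DiagonalFrameRP (planeSum (phantomT Φ)) :=
  ⟨hasWeakCouplingLimit_weakScheme _, polyVolume_weakScheme _, polyRenorm_weakScheme punitRep,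
    uniformFunctionalBoundPlanes_weakScheme punitRep, ⟨1, 0, one_pos, rpSpectral_of_subsingleton punitRep _ 1⟩,
    fun _ q F hn _ => tendsto_planeDist_phantomT h0 hvac hn q F, phantomT_bound Φ hα hbd,
    fun h => hnot (by rwa [planeSum_phantomT] at h)⟩

end LoadBearing

end Summit.QuantumFields.YangMills.Theorems.WeakCouplingHypercubicLimitRP.Negative.DiagRPOfPlaneLimits
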